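import Literature.NumberTheory.Sieve.ParityBarrier
import Literature.NumberTheory.Sieve.BombieriAsymptoticSieveMertens
import Literature.NumberTheory.Sieve.SieveFrameworkProofs
import HarnessLib

/-!
# Bombieri's asymptotic sieve: the `Λ_k` toolkit

Topic `Literature/NumberTheory/Sieve`, companion ("Proofs") file of `ParityBarrier.lean`, kept
separate so that the statement file keeps its imports. It collects the elementary, source-independent
tools that every proof of Bombieri's asymptotic sieve (`∑_{n ≤ x} a_n Λ_k(n) ∼ k H A(x)(log x)^{k−1}`,
`k ≥ 2`; Bombieri, Rend. Accad. Naz. XL (5) 1/2 (1975/76) [BombieriAsymptoticSieve1976];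
Friedlander–Iwaniec, Ann. Pisa (4) 5 (1978) 719–756 [FriedlanderIwaniecPisa1978], Theorem 1 and §4)
starts from.

## Contents (all PROVED)

1. `log` is a derivation of the Dirichlet ring (`pmul_log_mul`), `D(1) = 0`, `D(μ) = −Λ ⋆ μ`
   (`moebius_pmul_log`), and the resulting toolkit for the generalised von Mangoldt functions
   `Λ_k = μ ⋆ log^k` of `ParityBarrier.lean` (`Literature.NumberTheory.Sieve.generalizedVonMangoldt`): `Λ_0 = δ`,
   `ζ ⋆ Λ_k = log^k` (`∑_{d ∣ n} Λ_k(d) = (log n)^k`), the recursion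
   `Λ_{k+1} = Λ_k · log + Λ ⋆ Λ_k` (Bombieri 1976 §1; Friedlander–Iwaniec, Ann. Pisa (4) 5 (1978),
   §1 and Lemma 1; Iwaniec–Kowalski §1.4), whence `0 ≤ Λ_k(n) ≤ (log n)^k` and the support
   property `Λ_k(n) = 0` when `n` has more than `k` distinct prime factors
   ([FriedlanderIwaniecPisa1978] p. 721: "If `ω(n) > |k|`, then `Λ_{(k)}(n) = 0`", Lemma 1).
2. `SieveSequence.HasDensityConstant.nonneg`: the singular-series constant `H` of a density with
   `0 ≤ g(p) < 1` is `≥ 0` (limit of positive partial products).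
3. Two rearrangements needed by every evaluation of `S_k(x) = ∑_{n ≤ x} Λ_k(n) a_n`
   ([FriedlanderIwaniecPisa1978] §4): opening the convolution against a weight
   (`sum_Ioc_mul_apply_mul_eq_sum_sum`, `sum_generalizedVonMangoldt_mul_eq`) and the Type-I swap
   `∑_n a_n ∑_{d ∣ n, d ≤ D} λ_d = X ∑ λ_d g(d) + ∑ λ_d R_d` (`sum_mul_sum_divisors_le_eq`,
   `SieveSequence.sum_a_mul_sum_divisors_le_eq`).
4. `hasSieveDimension_reciprocalDensity_one_holds`: discharge of the named fact
   `Literature.NumberTheory.Sieve.hasSieveDimension_reciprocalDensity_one` of `ParityBarrier.lean` — the density `g(d) = 1/d` of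
   the integers (and of Selberg's sequences `1 ± λ(n)`) satisfies the dimension-`1` condition
   `HasSieveDimension g 1 K` with the explicit constant `K = e⁵`, from the tree's Chebyshev-level
   Mertens quotient bound `∏_{w ≤ p ≤ z} (1 − 1/p)⁻¹ ≤ e⁵ log z / log w`
   (`BombieriSieve.prod_primesGe_one_sub_inv_inv_le`, file `BombieriAsymptoticSieveMertens.lean`,
   whence the extra import).
5. `hasSieveDimension_shiftedPrimes_two_one_holds`: discharge of the named fact
   `Literature.NumberTheory.Sieve.hasSieveDimension_shiftedPrimes_two_one` of `ParityBarrier.lean` (parity.S26: the shifted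
   primes `Λ(n + 2)` have sieve dimension `1`) — the case `h = 2` of the discharged prelude fact
   `Literature.NumberTheory.Sieve.hasSieveDimension_shiftedPrimes_one` (`hasSieveDimension_shiftedPrimes_one_holds`, file
   `SieveFrameworkProofs.lean`, whence the second extra import).

## Status of `Literature.NumberTheory.Sieve.bombieri_asymptotic_sieve` (read before trying to discharge it)

The primary sources (Bombieri, RIMS Kôkyûroku 294 (1977) pp. 3–5 [BombieriRIMS1977];
Friedlander–Iwaniec, Ann. Pisa (4) 5 (1978) pp. 719–722, Theorem 1 (Bombieri)
[FriedlanderIwaniecPisa1978]) state the theorem under hypotheses (A₁)–(A₅) that include a POINTWISE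
bound on every remainder `R(x; d)`, `d < x` ((A₃)) and the analytic continuation of the density
series `∑ f(d)⁻¹ d^{−s} = ζ(s+1) G(s)` to `σ > −η` ((A₅)); the tree's `bombieri_asymptotic_sieve`
replaces these by a second-moment bound on `a_n` and Mertens-type asymptotics, which do not imply
them. The faithful statement is vendored separately (`Literature/NumberTheory/Sieve/
BombieriAsymptoticSieve.lean`: `Bombieri1976_asymptotic_sieve`, reduced there to the finite-level leaf
`Bombieri1976_asymptotic_sieve_finiteLevel`); no `bombieri_asymptotic_sieve_holds` is attempted here.

## Mathlib search

Mathlib (pinned) has `ArithmeticFunction.log`, `pmul`, `ppow`, `vonMangoldt` with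
`moebius_mul_log_eq_vonMangoldt`, `vonMangoldt_sum`, `vonMangoldt_le_log`, `coe_zeta_mul_coe_moebius`,
`isPrimePow_iff_card_primeFactors_eq_one`; it has no Leibniz rule for `pmul log`, no `Λ_k`, no
asymptotic sieve (`rg "Leibniz|derivation" Mathlib/NumberTheory/ArithmeticFunction`: nothing).
-/

noncomputable section

open Filter Asymptotics Finset ArithmeticFunction
-- `open ArithmeticFunction` already provides the notation `Λ`; opening the scope
-- `ArithmeticFunction.vonMangoldt` as well would make `Λ` ambiguous.
open scoped ArithmeticFunction.Moebius ArithmeticFunction.zeta ArithmeticFunction.omega Topology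

namespace Literature.NumberTheory.Sieve

/-! ### `log` is a derivation of the Dirichlet ring -/

/-- **Leibniz rule for `log`.** Pointwise multiplication by `log` is a derivation of the Dirichlet
ring of real arithmetic functions: `(f ⋆ g) · log = (f · log) ⋆ g + f ⋆ (g · log)`, because
`log(ab) = log a + log b` on each term of the convolution (Iwaniec–Kowalski §1.4; Apostol,
*Introduction to Analytic Number Theory*, §2.18, Thm 2.29 with the derivative `f'(n) = f(n) log n`). [folklore] -/
theorem pmul_log_mul (f g : ArithmeticFunction ℝ) :
    (f * g).pmul log = f.pmul log * g + f * g.pmul log := by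
  ext n
  simp only [pmul_apply, ArithmeticFunction.add_apply, mul_apply, log_apply, Finset.sum_mul]
  rw [← Finset.sum_add_distrib]
  refine Finset.sum_congr rfl fun x hx => ?_
  obtain ⟨hxn, hn⟩ := Nat.mem_divisorsAntidiagonal.mp hx
  have h1 : x.1 ≠ 0 := by
    rintro h
    rw [h, zero_mul] at hxn
    exact hn hxn.symm
  have h2 : x.2 ≠ 0 := by
    rintro h
    rw [h, mul_zero] at hxn
    exact hn hxn.symm
  rw [← hxn, Nat.cast_mul, Real.log_mul (by exact_mod_cast h1) (by exact_mod_cast h2)]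
  ring

/-- The Dirichlet unit is a `log`-constant: `δ · log = 0` (`log 1 = 0`). [folklore] -/
theorem one_pmul_log : (1 : ArithmeticFunction ℝ).pmul log = 0 := by
  ext n
  simp only [pmul_apply, one_apply, ArithmeticFunction.zero_apply, log_apply]
  split_ifs with h
  · simp [h]
  · simp

/-- `μ · log = −Λ ⋆ μ`: differentiate `μ ⋆ ζ = δ` with the Leibniz rule and use `ζ · log = log`,
`μ ⋆ log = Λ` (Iwaniec–Kowalski §1.4). [folklore] -/
theorem moebius_pmul_log :
    (μ : ArithmeticFunction ℝ).pmul log = -(Λ * (μ : ArithmeticFunction ℝ)) := by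
  have h := pmul_log_mul (μ : ArithmeticFunction ℝ) (ζ : ArithmeticFunction ℝ)
  rw [coe_moebius_mul_coe_zeta, one_pmul_log, zeta_pmul] at h
  have h2 : (μ : ArithmeticFunction ℝ).pmul log * ζ = -Λ := by
    rw [← moebius_mul_log_eq_vonMangoldt]
    linear_combination -h
  calc (μ : ArithmeticFunction ℝ).pmul log
        = (μ : ArithmeticFunction ℝ).pmul log * ζ * μ := by
          rw [mul_assoc, coe_zeta_mul_coe_moebius, mul_one]
    _ = -(Λ * (μ : ArithmeticFunction ℝ)) := by rw [h2, neg_mul]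

/-! ### The generalised von Mangoldt functions `Λ_k` -/

/-- `Λ_0 = μ ⋆ ζ = δ`, the Dirichlet unit (Mathlib's convention `ppow f 0 = ζ`). [folklore] -/
theorem generalizedVonMangoldt_zero : generalizedVonMangoldt 0 = 1 := by
  rw [generalizedVonMangoldt, ppow_zero, coe_moebius_mul_coe_zeta]

/-- Möbius inversion for `Λ_k`: `ζ ⋆ Λ_k = log^k` (Friedlander–Iwaniec, *Opera de Cribro*, §3.1;
Iwaniec–Kowalski §1.4). [folklore] -/
theorem coe_zeta_mul_generalizedVonMangoldt (k : ℕ) :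
    (ζ : ArithmeticFunction ℝ) * generalizedVonMangoldt k = log.ppow k := by
  rw [generalizedVonMangoldt, ← mul_assoc, coe_zeta_mul_coe_moebius, one_mul]

/-- `∑_{d ∣ n} Λ_k(d) = (log n)^k` for `k ≥ 1` (Möbius inversion, pointwise form). [folklore] -/
theorem generalizedVonMangoldt_sum {k : ℕ} (hk : 0 < k) (n : ℕ) :
    ∑ d ∈ n.divisors, generalizedVonMangoldt k d = Real.log n ^ k := by
  rw [← coe_zeta_mul_apply (f := generalizedVonMangoldt k), coe_zeta_mul_generalizedVonMangoldt,
    ppow_apply hk, log_apply]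

/-- **The recursion for `Λ_k`** (Bombieri 1976 §1; Friedlander–Iwaniec, *Opera de Cribro*, §3.1;
Iwaniec–Kowalski §1.4): `Λ_{k+1} = Λ_k · log + Λ ⋆ Λ_k`. Proof: apply the Leibniz rule
`pmul_log_mul` to `μ ⋆ log^k` and use `μ · log = −Λ ⋆ μ` (`moebius_pmul_log`). [folklore] -/
theorem generalizedVonMangoldt_succ (k : ℕ) :
    generalizedVonMangoldt (k + 1) =
      (generalizedVonMangoldt k).pmul log + Λ * generalizedVonMangoldt k := by
  have hD := pmul_log_mul (μ : ArithmeticFunction ℝ) (log.ppow k)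
  rw [moebius_pmul_log] at hD
  rw [generalizedVonMangoldt, ppow_succ', pmul_comm log (log.ppow k), generalizedVonMangoldt]
  linear_combination -hD

/-- The recursion pointwise: `Λ_{k+1}(n) = Λ_k(n) log n + ∑_{ab = n} Λ(a) Λ_k(b)`. [folklore] -/
theorem generalizedVonMangoldt_succ_apply (k n : ℕ) :
    generalizedVonMangoldt (k + 1) n =
      generalizedVonMangoldt k n * Real.log n +
        ∑ x ∈ n.divisorsAntidiagonal, Λ x.1 * generalizedVonMangoldt k x.2 := by
  rw [generalizedVonMangoldt_succ, ArithmeticFunction.add_apply, pmul_apply, mul_apply, log_apply]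

/-- **`Λ_k ≥ 0`** (Bombieri 1976 §1; Friedlander–Iwaniec §3.1): by induction on `k` from the
recursion, `Λ ≥ 0` and `log n ≥ 0`. [folklore] -/
theorem generalizedVonMangoldt_nonneg (k n : ℕ) : 0 ≤ generalizedVonMangoldt k n := by
  induction k generalizing n with
  | zero =>
    rw [generalizedVonMangoldt_zero, one_apply]
    split_ifs <;> norm_num
  | succ k ih =>
    rw [generalizedVonMangoldt_succ_apply]
    exact add_nonneg (mul_nonneg (ih n) (Real.log_natCast_nonneg n))
      (Finset.sum_nonneg fun x _ => mul_nonneg vonMangoldt_nonneg (ih x.2))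

/-- **`Λ_k(n) ≤ (log n)^k`** for `k ≥ 1` (Bombieri 1976 §1; Friedlander–Iwaniec §3.1): the term
`d = n` of the nonnegative sum `∑_{d ∣ n} Λ_k(d) = (log n)^k`. [folklore] -/
theorem generalizedVonMangoldt_le {k : ℕ} (hk : 0 < k) (n : ℕ) :
    generalizedVonMangoldt k n ≤ Real.log n ^ k := by
  rcases eq_or_ne n 0 with rfl | hn
  · simp [hk.ne']
  · rw [← generalizedVonMangoldt_sum hk n]
    exact Finset.single_le_sum (fun d _ => generalizedVonMangoldt_nonneg k d)
      (Nat.mem_divisors_self n hn)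

/-- `|Λ_k(n)| ≤ (log n)^k` for `k ≥ 1` (combining the two previous bounds). [folklore] -/
theorem abs_generalizedVonMangoldt_le {k : ℕ} (hk : 0 < k) (n : ℕ) :
    |generalizedVonMangoldt k n| ≤ Real.log n ^ k := by
  rw [abs_of_nonneg (generalizedVonMangoldt_nonneg k n)]
  exact generalizedVonMangoldt_le hk n

/-- **Support of `Λ_k`** (Bombieri 1976 §1; Friedlander–Iwaniec §3.1): `Λ_k(n) = 0` whenever `n`
has more than `k` distinct prime factors. Induction on `k` via the recursion: in `Λ ⋆ Λ_k`, `Λ(a) ≠ 0`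
forces `a` to be a prime power, so `ω(n) ≤ ω(a) + ω(b) = 1 + ω(b)`. [folklore] -/
theorem generalizedVonMangoldt_eq_zero_of_lt_card_primeFactors {k n : ℕ}
    (h : k < n.primeFactors.card) : generalizedVonMangoldt k n = 0 := by
  induction k generalizing n with
  | zero =>
    rw [generalizedVonMangoldt_zero, one_apply_ne]
    rintro rfl
    simp at h
  | succ k ih =>
    rw [generalizedVonMangoldt_succ_apply, ih (by omega), zero_mul, zero_add]
    refine Finset.sum_eq_zero fun x hx => ?_
    obtain ⟨hxn, hn⟩ := Nat.mem_divisorsAntidiagonal.mp hx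
    by_cases ha : IsPrimePow x.1
    · have h1 : x.1 ≠ 0 := ha.ne_zero
      have h2 : x.2 ≠ 0 := by
        rintro h2
        rw [h2, mul_zero] at hxn
        exact hn hxn.symm
      have hcard : n.primeFactors.card ≤ x.1.primeFactors.card + x.2.primeFactors.card := by
        rw [← hxn, Nat.primeFactors_mul h1 h2]
        exact Finset.card_union_le _ _
      rw [isPrimePow_iff_card_primeFactors_eq_one.mp ha] at hcard
      rw [ih (by omega), mul_zero]
    · rw [vonMangoldt_eq_zero_iff.mpr ha, zero_mul]

/-- `Λ_k(n) = 0` for `k ≥ 1` unless `n ≥ 2` (`Λ_k(0) = 0` by convention and `Λ_k(1) = (log 1)^k = 0`).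
[folklore] -/
theorem generalizedVonMangoldt_eq_zero_of_le_one {k n : ℕ} (hk : 0 < k) (hn : n ≤ 1) :
    generalizedVonMangoldt k n = 0 := by
  interval_cases n
  · exact ArithmeticFunction.map_zero
  · have h1 := generalizedVonMangoldt_le hk 1
    simp only [Nat.cast_one, Real.log_one, zero_pow hk.ne'] at h1
    exact le_antisymm h1 (generalizedVonMangoldt_nonneg k 1)

/-! ### The singular-series constant is nonnegative -/

/-- Under `0 ≤ g(p) < 1` on the primes (part of `HasSieveDimension`), every partial product
`∏_{p ≤ x} (1 − g(p))(1 − 1/p)⁻¹` is nonnegative, hence so is its limit `H`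
(Friedlander–Iwaniec (3.21); Bombieri 1976 (1.6)). [folklore] -/
theorem SieveSequence.HasDensityConstant.nonneg {A : SieveSequence} {H κ K : ℝ}
    (hH : A.HasDensityConstant H) (hdim : HasSieveDimension A.density κ K) : 0 ≤ H :=
  ge_of_tendsto' hH fun x => Finset.prod_nonneg fun p hp => by
    have hp' := (Nat.mem_primesLE.mp hp).2
    have h1 : A.density p < 1 := (hdim.1 p hp').2
    have h2 : (p : ℝ)⁻¹ < 1 := inv_lt_one_of_one_lt₀ (by exact_mod_cast hp'.one_lt)
    exact div_nonneg (sub_nonneg.mpr h1.le) (sub_nonneg.mpr h2.le)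

/-! ### Two rearrangements used by every evaluation of `S_k(x)` -/

/-- **Opening the convolution against a weight** (Dirichlet's rearrangement; Friedlander–Iwaniec,
*Opera de Cribro*, §1.3–§3.2; Iwaniec–Kowalski §1.4): for arithmetic functions `f, g` and any weight
`a`, `∑_{n ≤ N} (f ⋆ g)(n) a_n = ∑_{d ≤ N} f(d) ∑_{m ≤ N/d} g(m) a_{dm}`. With `f = μ`, `g = log^k`
this writes `S_k(x) = ∑_{n ≤ x} Λ_k(n) a_n` as `∑_d μ(d) ∑_{m ≤ x/d} a_{dm} (log m)^k`
(`sum_generalizedVonMangoldt_mul_eq`). Mathlib's `ArithmeticFunction.sum_Ioc_mul_eq_sum_sum` is the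
unweighted case `a = 1`. [folklore] -/
theorem sum_Ioc_mul_apply_mul_eq_sum_sum (f g : ArithmeticFunction ℝ) (a : ℕ → ℝ) (N : ℕ) :
    ∑ n ∈ Ioc 0 N, (f * g) n * a n =
      ∑ d ∈ Ioc 0 N, f d * ∑ m ∈ Ioc 0 (N / d), g m * a (d * m) := by
  have hstep : ∀ n ∈ Ioc 0 N, (f * g) n * a n =
      ∑ x ∈ n.divisorsAntidiagonal, f x.1 * (g x.2 * a (x.1 * x.2)) := by
    intro n _
    rw [mul_apply, Finset.sum_mul]
    refine Finset.sum_congr rfl fun x hx => ?_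
    rw [(Nat.mem_divisorsAntidiagonal.mp hx).1]
    ring
  rw [Finset.sum_congr rfl hstep]
  rw [Finset.sum_comm' (s' := fun y : ℕ × ℕ => ({y.1 * y.2} : Finset ℕ))
    (t' := (Ioc 0 N ×ˢ Ioc 0 N).filter fun y : ℕ × ℕ => y.1 * y.2 ≤ N)]
  · rw [Finset.sum_filter, Finset.sum_product]
    refine Finset.sum_congr rfl fun d hd => ?_
    have hd0 : 0 < d := (Finset.mem_Ioc.mp hd).1
    rw [Finset.mul_sum, ← Finset.sum_filter]
    refine Finset.sum_congr ?_ fun m _ => by rw [Finset.sum_singleton]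
    ext m
    simp only [Finset.mem_filter, Finset.mem_Ioc, Nat.le_div_iff_mul_le hd0]
    constructor
    · rintro ⟨⟨hm0, -⟩, hdm⟩
      exact ⟨hm0, by rwa [mul_comm] at hdm⟩
    · rintro ⟨hm0, hmd⟩
      refine ⟨⟨hm0, ?_⟩, by rwa [mul_comm] at hmd⟩
      exact le_trans (Nat.le_mul_of_pos_right m hd0) hmd
  · intro n y
    simp only [Finset.mem_singleton, Finset.mem_filter, Finset.mem_product, Finset.mem_Ioc,
      Nat.mem_divisorsAntidiagonal]
    constructor
    · rintro ⟨⟨hn0, hnN⟩, hyn, -⟩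
      have hy1 : 0 < y.1 := Nat.pos_of_ne_zero fun h => by
        rw [h, zero_mul] at hyn
        omega
      have hy2 : 0 < y.2 := Nat.pos_of_ne_zero fun h => by
        rw [h, mul_zero] at hyn
        omega
      refine ⟨hyn.symm, ⟨⟨hy1, ?_⟩, hy2, ?_⟩, ?_⟩
      · calc y.1 ≤ y.1 * y.2 := Nat.le_mul_of_pos_right y.1 hy2
          _ = n := hyn
          _ ≤ N := hnN
      · calc y.2 ≤ y.1 * y.2 := Nat.le_mul_of_pos_left y.2 hy1
          _ = n := hyn
          _ ≤ N := hnN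
      · calc y.1 * y.2 = n := hyn
          _ ≤ N := hnN
    · rintro ⟨rfl, ⟨⟨hy1, -⟩, hy2, -⟩, hle⟩
      exact ⟨⟨Nat.mul_pos hy1 hy2, hle⟩, rfl, (Nat.mul_pos hy1 hy2).ne'⟩

/-- `S_k(x)` opened up (Bombieri 1976 §2; Friedlander–Iwaniec §3.2):
`∑_{n ≤ N} Λ_k(n) a_n = ∑_{d ≤ N} μ(d) ∑_{m ≤ N/d} (log m)^k a_{dm}` for `k ≥ 1`. [folklore] -/
theorem sum_generalizedVonMangoldt_mul_eq {k : ℕ} (hk : 0 < k) (a : ℕ → ℝ) (N : ℕ) :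
    ∑ n ∈ Ioc 0 N, generalizedVonMangoldt k n * a n =
      ∑ d ∈ Ioc 0 N, (μ d : ℝ) * ∑ m ∈ Ioc 0 (N / d), Real.log m ^ k * a (d * m) := by
  rw [generalizedVonMangoldt, sum_Ioc_mul_apply_mul_eq_sum_sum]
  simp only [intCoe_apply, ppow_apply hk, log_apply]

/-- **Swapping a truncated divisor sum against the sequence** (the Type-I rearrangement;
Halberstam–Richert Ch. 1 (1.2)–(1.4); Friedlander–Iwaniec (1.24)): for weights `λ_d` supported on
`d ≤ D`, `∑_{n ≤ N} a_n ∑_{d ∣ n, d ≤ D} λ_d = ∑_{d ≤ D} λ_d ∑_{n ≤ N, d ∣ n} a_n`. [folklore] -/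
theorem sum_mul_sum_divisors_le_eq (a lam : ℕ → ℝ) (N D : ℕ) :
    ∑ n ∈ Ioc 0 N, a n * ∑ d ∈ n.divisors with d ≤ D, lam d =
      ∑ d ∈ Ioc 0 D, lam d * ∑ n ∈ (Ioc 0 N).filter (d ∣ ·), a n := by
  simp_rw [Finset.mul_sum]
  rw [Finset.sum_comm' (s' := fun d => (Ioc 0 N).filter (d ∣ ·)) (t' := Ioc 0 D)]
  · exact Finset.sum_congr rfl fun d _ => Finset.sum_congr rfl fun n _ => mul_comm _ _
  · intro n d
    simp only [Finset.mem_filter, Nat.mem_divisors, Finset.mem_Ioc]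
    constructor
    · rintro ⟨⟨hn0, hnN⟩, ⟨hdn, -⟩, hdD⟩
      exact ⟨⟨⟨hn0, hnN⟩, hdn⟩, Nat.pos_of_dvd_of_pos hdn hn0, hdD⟩
    · rintro ⟨⟨⟨hn0, hnN⟩, hdn⟩, hd0, hdD⟩
      exact ⟨⟨hn0, hnN⟩, ⟨hdn, by omega⟩, hdD⟩

/-- The Type-I rearrangement on the sequence layer: with `A_d(x) = 𝒜.congrSum d x` and
`R_d(x) = 𝒜.remainder d x = A_d(x) − g(d) X(x)`,
`∑_{n ≤ x} a_n ∑_{d ∣ n, d ≤ D} λ_d = X(x) ∑_{d ≤ D} λ_d g(d) + ∑_{d ≤ D} λ_d R_d(x)`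
(Halberstam–Richert Ch. 1 (1.4)–(1.5); Friedlander–Iwaniec (1.24)–(1.25)). [folklore] -/
theorem SieveSequence.sum_a_mul_sum_divisors_le_eq (A : SieveSequence) (lam : ℕ → ℝ) (x : ℝ)
    (D : ℕ) :
    ∑ n ∈ Ioc 0 ⌊x⌋₊, A.a n * ∑ d ∈ n.divisors with d ≤ D, lam d =
      A.size x * ∑ d ∈ Ioc 0 D, lam d * A.density d +
        ∑ d ∈ Ioc 0 D, lam d * A.remainder d x := by
  rw [_root_.Literature.NumberTheory.Sieve.sum_mul_sum_divisors_le_eq, Finset.mul_sum, ← Finset.sum_add_distrib]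
  refine Finset.sum_congr rfl fun d _ => ?_
  rw [SieveSequence.remainder, SieveSequence.congrSum]
  ring

/-! ### The density `1/d` has sieve dimension `1` -/

/-- **Discharge of `hasSieveDimension_reciprocalDensity_one`** (Halberstam–Richert, *Sieve Methods*,
Ch. 2: under `(Ω₁)`, `(Ω₂(κ))` one has `V(w)/V(z) = ∏_{w ≤ p < z} (1 − ω(p)/p)⁻¹ ≪ (log z / log w)^κ`,
here with `ω(p) = 1`, `κ = 1`; the prime-number input is Mertens' product formula
`∏_{p ≤ x} (1 − 1/p)⁻¹ = e^γ log x + O(1)`, Montgomery–Vaughan Thm 2.7(e)). PROVED, with the explicit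
constant `K = e⁵`: `0 ≤ 1/p < 1` for every prime `p`, and for `2 ≤ w ≤ z` the primes `w ≤ p < ⌈z⌉`
form a subset of the primes `w ≤ p ≤ ⌊z⌋`, each factor `(1 − 1/p)⁻¹` is `≥ 1`, so the product is at
most the tree's Chebyshev-level Mertens quotient bound `∏_{w ≤ p ≤ z} (1 − 1/p)⁻¹ ≤ e⁵ log z / log w`
(`BombieriSieve.prod_primesGe_one_sub_inv_inv_le`). [cite: HalberstamRichert1974, Ch. 2 Lemma 2.4 (Mertens)] [cite: MontgomeryVaughan2007, Thm. 2.7(e)] -/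
theorem hasSieveDimension_reciprocalDensity_one_holds : hasSieveDimension_reciprocalDensity_one := by
  refine ⟨Real.exp 5, fun p hp => ?_, fun w z hw hwz => ?_⟩
  · rw [reciprocalDensity_apply]
    exact ⟨inv_nonneg.mpr (Nat.cast_nonneg p),
      inv_lt_one_of_one_lt₀ (by exact_mod_cast hp.one_lt)⟩
  · rw [Real.rpow_one, ← mul_div_assoc]
    simp only [reciprocalDensity_apply]
    refine le_trans (Finset.prod_le_prod_of_subset_of_one_le (fun p hp => ?_) (fun p _ => ?_)
      (fun p hp _ => ?_)) (BombieriSieve.prod_primesGe_one_sub_inv_inv_le hw hwz)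
    · -- `w ≤ p < ⌈z⌉` implies `w ≤ p ≤ ⌊z⌋`
      obtain ⟨hp, hwp⟩ := Finset.mem_filter.mp hp
      obtain ⟨hpz, hpp⟩ := Nat.mem_primesBelow.mp hp
      exact BombieriSieve.mem_primesGe.mpr ⟨hpp, hwp, Nat.le_floor (Nat.lt_ceil.mp hpz).le⟩
    · exact inv_nonneg.mpr (sub_nonneg.mpr (Nat.cast_inv_le_one p))
    · have hp1 : (1 : ℝ) < p := by exact_mod_cast (BombieriSieve.mem_primesGe.mp hp).1.one_lt
      exact (one_le_inv₀ (sub_pos.mpr (inv_lt_one_of_one_lt₀ hp1))).mpr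
        (sub_le_self _ (inv_nonneg.mpr (Nat.cast_nonneg p)))

/-! ### The shifted primes `Λ(n + 2)` have sieve dimension `1` -/

/-- **Discharge of `hasSieveDimension_shiftedPrimes_two_one`** (parity.S26). The density of the
shifted primes `a_n = Λ(n + 2)` — `g(p) = 1/(p − 1)` for odd `p`, `g(2) = 0` — satisfies the
dimension-`1` condition `Ω(1)`: `0 ≤ g(p) < 1` and `∏_{w ≤ p < z} (1 − g(p))⁻¹ ≤ K log z / log w` for
`2 ≤ w ≤ z`, for some constant `K`. This is the linear-sieve hypothesis (9.34) verified for
`g = 1/φ`, `2 ∉ 𝒫` in Nathanson, *Additive Number Theory: The Classical Bases*, §10.3 "Prolegomena to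
sieving", pp. 275–276 (`∏_{u ≤ p < z} (1 − 1/(p−1))⁻¹ = ∏ (p−1)²/(p(p−2)) · ∏ (1 − 1/p)⁻¹` and Mertens,
Thm 6.9); Halberstam–Richert, *Sieve Methods*, Ch. 2 (condition `Ω₂(κ)`, `κ = 1`). PROVED as the case
`h = 2` (`even_two`) of the discharged prelude fact `hasSieveDimension_shiftedPrimes_one`
(`hasSieveDimension_shiftedPrimes_one_holds`, `SieveFrameworkProofs.lean`, explicit
`K = exp(17/2 + 6/log 2)`). [cite: Nathanson1996, §10.3 pp. 275–276 (verification of (9.34) for g = 1/φ)] -/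
theorem hasSieveDimension_shiftedPrimes_two_one_holds : hasSieveDimension_shiftedPrimes_two_one :=
  hasSieveDimension_shiftedPrimes_one_holds even_two

end Literature.NumberTheory.Sieve
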